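import Mathlib
import Summits.Ventures.PercRepro2.Defs
import Summits.Ventures.PercRepro2.Graph
import Summits.Ventures.PercRepro2.Events
import Summits.Ventures.PercRepro2.Harris
import Summits.Ventures.PercRepro2.HCov
import Summits.Ventures.PercRepro2.HCovDiag
import Summits.Ventures.PercRepro2.LeafLinearity

/-!
# The covariance form vanishes when the root `a₁` coincides with another mark
(blind cell PercRepro2, mine-2 g14; MINE2-RECM.md fact (iii) — «contracting a root edge into a mark kills `Gc`»)

Four exact zeros of `Gc`, valid for every weighted graph and every vertex:
* `Gc_a2_eq_a1 : Gc p ends o a₁ a₁ a₃ b = 0` — `Q = {a₁ ↮ a₁} = ∅`;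
* `Gc_a3_eq_a1 : Gc p ends o a₁ a₂ a₁ b = 0` — `PD = Q ∩ {a₁ ∉ U} = ∅`, and every term of `Gc` carries `D`, `D_o`,
  `PDb` or `PDbo`;
* `Gc_o_eq_a1 : Gc p ends a₁ a₁ a₂ a₃ b = 0` — under `Q`, `σ_o ≡ 1` and `o ∈ U`, so `F ≡ 1`: the `o`-masses collapse
  onto the `o`-free ones (`EQbo = E_Q[σ_b]`, `EQb3o = EQb3`, `D_o = D`, `EQo = P(Q)`, `EQ3o = EQ3`, `PDbo = PDb`) and the
  two brackets cancel against `gap = −E_Q[σ_b]`;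
* `Gc_b_eq_a1 : Gc p ends o a₁ a₂ a₃ a₁ = 0` — `σ_b ≡ 1`, `gap = −P(Q)`, and `Gc = P(Q)·DEF − P(Q)·DEF`.

Consequences through `LeafLinearity` (`Gc(v leaf at x) = q·Gc(v := x)`): `o` or `b` a leaf at a root gives `Gc = 0`
(the (SEP-2) / (SEP-3) zeros of the one-far-mark table), and for the root-edge reduction of 2′CW-RECM the contraction of a root
edge into any mark is a vanishing instance.
-/

namespace Summit.Ventures.PercRepro2
namespace RootCoincidence

open CovForm UnionCluster

variable {V : Type*} {E : Type*} [Fintype E] [DecidableEq E] [DecidableEq V]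
  {R : Type*} [Field R] [LinearOrder R] [IsStrictOrderedRing R]

section Sets

variable {ends : E → Sym2 V}

omit [Fintype E] [DecidableEq E] [DecidableEq V] in
/-- `{u ↔ u} = univ`. -/
lemma connEvent_self (ends : E → Sym2 V) (u : V) : connEvent ends u u = Set.univ := by
  ext ω; simp only [mem_connEvent, Set.mem_univ, iff_true]; exact conn_refl ends ω u

omit [Fintype E] [DecidableEq E] [DecidableEq V] in
/-- `Q = {a₂ ↮ a₁}` is empty when `a₂ = a₁`. -/
lemma avoidAll_self (ends : E → Sym2 V) (a : V) : avoidAll ends a {a} = ∅ := by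
  ext ω
  simp only [mem_avoidAll, Finset.mem_singleton, forall_eq, Set.mem_empty_iff_false, iff_false, not_not]
  exact conn_refl ends ω a

omit [Fintype E] [DecidableEq E] [DecidableEq V] in
/-- `PD = ∅` when `a₃ = a₁` (`a₁ ∈ U` always). -/
lemma PDEvent_a3_eq_a1 (ends : E → Sym2 V) (a₁ a₂ : V) : PDEvent ends a₁ a₂ a₁ = ∅ := by
  ext ω
  simp only [PDEvent, Dtilde, Set.mem_inter_iff, Set.mem_compl_iff, Set.mem_empty_iff_false, iff_false,
    not_and]
  intro _ h; exact h (Or.inl (conn_refl ends ω a₁))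

omit [Fintype E] [DecidableEq E] [DecidableEq V] in
/-- Under `Q`, `{a₂ ↔ a₁}` is impossible: `Q ∩ (X ∩ {a₂ ↔ a₁}) = ∅` and `Q ∩ ({a₂ ↔ a₁} ∩ X) = ∅`. -/
lemma Q_inter_conn21 (ends : E → Sym2 V) (a₁ a₂ : V) (X : Set (Config E)) :
    avoidAll ends a₂ {a₁} ∩ (X ∩ connEvent ends a₂ a₁) = ∅ ∧
      avoidAll ends a₂ {a₁} ∩ (connEvent ends a₂ a₁ ∩ X) = ∅ ∧
      avoidAll ends a₂ {a₁} ∩ connEvent ends a₂ a₁ = ∅ := by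
  refine ⟨?_, ?_, ?_⟩ <;> ext ω <;>
    simp only [Set.mem_inter_iff, mem_avoidAll, Finset.mem_singleton, forall_eq, mem_connEvent,
      Set.mem_empty_iff_false, iff_false, not_and] <;> tauto

omit [Fintype E] [DecidableEq E] [DecidableEq V] in
/-- `T ∩ {a₂ ↔ a₁}`-type intersections vanish: `T ⊆ Q`, `T′ ⊆ Q`, `PD ⊆ Q`. -/
lemma sub_Q_inter_conn21 (ends : E → Sym2 V) (a₁ a₂ : V) (W X : Set (Config E))
    (hW : ∀ ω ∈ W, ¬ Conn ends ω a₂ a₁) :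
    W ∩ (X ∩ connEvent ends a₂ a₁) = ∅ ∧ W ∩ (connEvent ends a₂ a₁ ∩ X) = ∅ ∧
      W ∩ connEvent ends a₂ a₁ = ∅ := by
  refine ⟨?_, ?_, ?_⟩ <;> ext ω <;>
    simp only [Set.mem_inter_iff, mem_connEvent, Set.mem_empty_iff_false, iff_false, not_and] <;>
    intro h <;> first | exact fun _ h2 => hW ω h h2 | exact fun h2 _ => hW ω h h2 | exact hW ω h

end Sets

omit [DecidableEq V] [LinearOrder R] [IsStrictOrderedRing R] in
/-- **`Gc = 0` when the two roots coincide** (`Q = ∅`). -/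
theorem Gc_a2_eq_a1 (p : E → R) (ends : E → Sym2 V) (o a₁ a₃ b : V) :
    Gc p ends o a₁ a₁ a₃ b = 0 := by
  have hQ := avoidAll_self ends a₁
  have hT : TEvent ends a₁ a₁ a₃ = ∅ := by
    ext ω; simp only [TEvent, Set.mem_inter_iff, Set.mem_compl_iff, mem_connEvent,
      Set.mem_empty_iff_false, iff_false, not_and]; intro h; exact (h (conn_refl ends ω a₁)).elim
  have hPD : PDEvent ends a₁ a₁ a₃ = ∅ := by
    ext ω; simp only [PDEvent, Set.mem_inter_iff, Set.mem_compl_iff, mem_connEvent,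
      Set.mem_empty_iff_false, iff_false, not_and]; intro h; exact (h (conn_refl ends ω a₁)).elim
  unfold Gc DEF EQbo EQb3 EQb3o EQo EQ3 EQ3o PDb PDbo Do gap
  simp only [hQ, hT, hPD, Set.empty_inter, prob_empty, sub_self]
  ring

omit [DecidableEq V] [LinearOrder R] [IsStrictOrderedRing R] in
/-- **`Gc = 0` when `a₃` coincides with the root `a₁`** (`PD = ∅`). -/
theorem Gc_a3_eq_a1 (p : E → R) (ends : E → Sym2 V) (o a₁ a₂ b : V) :
    Gc p ends o a₁ a₂ a₁ b = 0 := by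
  have hPD := PDEvent_a3_eq_a1 ends a₁ a₂
  unfold Gc DEF EQo EQ3 EQ3o PDb PDbo Do
  simp only [hPD, Set.empty_inter, prob_empty]
  ring

omit [DecidableEq V] in
/-- **`Gc = 0` when `o` coincides with the root `a₁`** (`σ_o ≡ 1`, `F ≡ 1`). -/
theorem Gc_o_eq_a1 (p : E → R) (ends : E → Sym2 V) (a₁ a₂ a₃ b : V) :
    Gc p ends a₁ a₁ a₂ a₃ b = 0 := by
  have h11 := connEvent_self ends a₁
  obtain ⟨_, q2, q3⟩ := Q_inter_conn21 ends a₁ a₂ (connEvent ends a₁ b)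
  obtain ⟨_, q2', _⟩ := Q_inter_conn21 ends a₁ a₂ (connEvent ends a₂ b)
  have hT : ∀ ω ∈ TEvent ends a₁ a₂ a₃, ¬ Conn ends ω a₂ a₁ := fun _ h => h.1
  have hT' : ∀ ω ∈ TEvent ends a₂ a₁ a₃, ¬ Conn ends ω a₂ a₁ := fun _ h h' => h.1 (conn_symm h')
  have hP : ∀ ω ∈ PDEvent ends a₁ a₂ a₃, ¬ Conn ends ω a₂ a₁ := fun _ h h' => h.1 (conn_symm h')
  obtain ⟨_, t2, t3⟩ := sub_Q_inter_conn21 ends a₁ a₂ _ (connEvent ends a₁ b) hT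
  obtain ⟨_, t2', _⟩ := sub_Q_inter_conn21 ends a₁ a₂ _ (connEvent ends a₂ b) hT
  obtain ⟨_, u2, u3⟩ := sub_Q_inter_conn21 ends a₁ a₂ _ (connEvent ends a₁ b) hT'
  obtain ⟨_, u2', _⟩ := sub_Q_inter_conn21 ends a₁ a₂ _ (connEvent ends a₂ b) hT'
  obtain ⟨_, v2, v3⟩ := sub_Q_inter_conn21 ends a₁ a₂ _ (connEvent ends a₁ b) hP
  obtain ⟨_, v2', _⟩ := sub_Q_inter_conn21 ends a₁ a₂ _ (connEvent ends a₂ b) hP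
  have hgap := gap_eq_Q p ends a₁ a₂ b
  unfold Gc DEF EQbo EQb3 EQb3o EQo EQ3 EQ3o PDb PDbo Do
  rw [hgap]
  simp only [h11, Set.univ_inter, Set.inter_univ, q2, q3, q2', t2, t3, t2', u2, u3, u2', v2, v3, v2',
    prob_empty]
  ring

omit [DecidableEq V] in
/-- **`Gc = 0` when `b` coincides with the root `a₁`** (`σ_b ≡ 1`, `gap = −P(Q)`). -/
theorem Gc_b_eq_a1 (p : E → R) (ends : E → Sym2 V) (o a₁ a₂ a₃ : V) :
    Gc p ends o a₁ a₂ a₃ a₁ = 0 := by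
  have h11 := connEvent_self ends a₁
  obtain ⟨q1, _, q3⟩ := Q_inter_conn21 ends a₁ a₂ (connEvent ends a₁ o)
  obtain ⟨q1', _, _⟩ := Q_inter_conn21 ends a₁ a₂ (connEvent ends a₂ o)
  have hT : ∀ ω ∈ TEvent ends a₁ a₂ a₃, ¬ Conn ends ω a₂ a₁ := fun _ h => h.1
  have hT' : ∀ ω ∈ TEvent ends a₂ a₁ a₃, ¬ Conn ends ω a₂ a₁ := fun _ h h' => h.1 (conn_symm h')
  have hP : ∀ ω ∈ PDEvent ends a₁ a₂ a₃, ¬ Conn ends ω a₂ a₁ := fun _ h h' => h.1 (conn_symm h')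
  obtain ⟨t1, _, t3⟩ := sub_Q_inter_conn21 ends a₁ a₂ _ (connEvent ends a₁ o) hT
  obtain ⟨t1', _, _⟩ := sub_Q_inter_conn21 ends a₁ a₂ _ (connEvent ends a₂ o) hT
  obtain ⟨u1, _, u3⟩ := sub_Q_inter_conn21 ends a₁ a₂ _ (connEvent ends a₁ o) hT'
  obtain ⟨u1', _, _⟩ := sub_Q_inter_conn21 ends a₁ a₂ _ (connEvent ends a₂ o) hT'
  obtain ⟨v1, _, v3⟩ := sub_Q_inter_conn21 ends a₁ a₂ _ (connEvent ends a₁ o) hP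
  obtain ⟨v1', _, _⟩ := sub_Q_inter_conn21 ends a₁ a₂ _ (connEvent ends a₂ o) hP
  have hgap := gap_eq_Q p ends a₁ a₂ a₁
  unfold Gc DEF EQbo EQb3 EQb3o EQo EQ3 EQ3o PDb PDbo Do
  rw [hgap]
  simp only [h11, Set.inter_univ, q1, q3, q1', t1, t3, t1', u1, u3, u1', v1, v3, v1', prob_empty]
  ring

omit [DecidableEq V] in
/-- `o` a leaf at a root: `Gc = 0` (the (SEP-3) zero), via leaf linearity. -/
theorem Gc_o_leaf_at_root (p : E → R) (ends : E → Sym2 V) {f : E} {o a₁ : V} (hf : ends f = s(o, a₁))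
    (hleaf : ∀ e, o ∈ ends e → e = f) (ho1 : o ≠ a₁) {a₂ a₃ b : V} (ho2 : o ≠ a₂) (ho3 : o ≠ a₃)
    (hob : o ≠ b) : Gc p ends o a₁ a₂ a₃ b = 0 := by
  rw [LeafLinearity.Gc_leaf_o p ends hf hleaf ho1 ho1 ho2 ho3 hob, Gc_o_eq_a1, mul_zero]

omit [DecidableEq V] in
/-- `b` a leaf at a root: `Gc = 0` (the (SEP-2) zero), via leaf linearity. -/
theorem Gc_b_leaf_at_root (p : E → R) (ends : E → Sym2 V) {f : E} {b a₁ : V} (hf : ends f = s(b, a₁))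
    (hleaf : ∀ e, b ∈ ends e → e = f) (hb1 : b ≠ a₁) {o a₂ a₃ : V} (hbo : b ≠ o) (hb2 : b ≠ a₂)
    (hb3 : b ≠ a₃) : Gc p ends o a₁ a₂ a₃ b = 0 := by
  rw [LeafLinearity.Gc_leaf_b p ends hf hleaf hb1 hbo hb1 hb2 hb3, Gc_b_eq_a1, mul_zero]

end RootCoincidence
end Summit.Ventures.PercRepro2
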